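import Summits.QuantumFields.YangMills.Theorems.ColdStartUniversalityLatticeLangevinWilsonSpectralGap
import Summits.QuantumFields.YangMills.Theorems.ColdStartUniversalityLatticeLangevinLawDensityBound
import HarnessLib

/-!
# Route `ColdStartUniversality` (fixed-cut-off `L²(μ_{β'})` package): `L²` MIXING OF THE SZZ DYNAMICS FROM A DETERMINISTIC
# (e.g. COLD) START at the spectral rate — `|E F(U_{t₁+t}) − μ(F)| ≤ √D · e^{-ct} · σ_μ(F)`

Helper file (seat `ym-line-csu-p1`, g16), sequel of `…WilsonSpectralGap`.  For the SU(2) lattice Langevin dynamics at any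
coupling `β'` (`μ = μ_{β'}` the Wilson measure, `c = c(L, β') > 0` the Doeblin rate, which is an `L²(μ)` rate with constant
one by `wilson_spectralGap`):

* ★ `coldStart_sq_sub_le_exp` — for every deterministic start `z` and burn-in time `t₁ > 0` there is `D = D(L, β', z, t₁) ≥ 0`
  such that for EVERY strong solution `U` from `z` on ANY probability space (any flat driver), every continuous observable `F`
  and every lattice time `t`:
  `(E F(U_{t₁+t}) − ∫ F dμ)² ≤ D · e^{-2ct} · ∫ (F − μF)² dμ`.
  Route: `law(U_{t₁+t}) = (κ_{t₁} z) ∘ κ_t` (THE kernels, Chapman–Kolmogorov), `κ_{t₁} z ≤ D · μ` (the tree's density bound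
  `map_le_smul_haar` + `Haar ≤ a μ`, `wilsonMeasure_le_smul_pi_haar_and`), Jensen under `κ_{t₁} z`, and the variance decay
  `∫ (κ_t F − μF)² dμ ≤ e^{-2ct} Var_μ(F)` of `wilson_spectralGap`.

Reading: after any positive burn-in the cold-start dynamics relaxes in `L²` at the spectral rate, the observable entering only
through its standard deviation under `μ` (vs. the sup norm in `exp_mixing_szz`); the price is the prefactor `√D`, `D` a bound
for the density of `law(U_{t₁})` w.r.t. `μ_K` — of size `exp(#links)`, which is why LINE 4 «cold_entropy» budgets `log D`
(entropy) instead.  THEOREMS ONLY, no definition, no sorry.  HONEST FRAMING: fixed-cut-off plumbing, nothing uniform in the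
cut-off; no rung, crux or summit statement is proved; the Yang–Mills mass gap is NOT proved.
-/

set_option autoImplicit false

noncomputable section

namespace Summit.QuantumFields.YangMills.Theorems.ColdStartUniversality

open MeasureTheory ProbabilityTheory Finset Filter Set Topology
open scoped BigOperators NNReal ENNReal
open Literature.Probability.Process Literature.MathematicalPhysics.QuantumFieldTheory
open Literature.MathematicalPhysics.QuantumLattice (fundamentalRep fundamentalLatticeRep continuous_fundamentalRep)

variable {L : ℕ} [NeZero L]

/-- **Jensen + domination**: if `ν ≤ D · μ` (`ν` a probability measure, `μ` finite) then `(∫ G dν)² ≤ D ∫ G² dμ` for every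
continuous `G` on the compact configuration space. [folklore] -/
theorem sq_integral_le_mul_integral_sq {ν μ : Measure (GaugeConfig 3 L (Matrix.specialUnitaryGroup (Fin 2) ℂ))}
    [IsProbabilityMeasure ν] [IsFiniteMeasure μ] {D : ℝ} (hD : 0 ≤ D) (hle : ν ≤ (ENNReal.ofReal D) • μ)
    {G : GaugeConfig 3 L (Matrix.specialUnitaryGroup (Fin 2) ℂ) → ℝ} (hG : Continuous G) :
    (∫ y, G y ∂ν) ^ 2 ≤ D * ∫ y, (G y) ^ 2 ∂μ := by
  haveI := secondCountableTopology_su2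
  haveI := borelSpace_config L
  obtain ⟨M, -, hM⟩ := exists_abs_le_of_continuous hG
  have h1 : (∫ y, G y ∂ν) ^ 2 ≤ ∫ y, (G y) ^ 2 ∂ν := sq_integral_le_integral_sq_of_bounded ν hG.measurable hM
  have hGi : Integrable (fun y => (G y) ^ 2) ((ENNReal.ofReal D) • μ) :=
    (integrable_of_continuous_of_compactSpace (hG.pow 2) μ).smul_measure ENNReal.ofReal_ne_top
  have h2 : ∫ y, (G y) ^ 2 ∂ν ≤ ∫ y, (G y) ^ 2 ∂((ENNReal.ofReal D) • μ) :=
    integral_mono_measure hle (Eventually.of_forall fun y => sq_nonneg (G y)) hGi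
  rw [integral_smul_measure, ENNReal.toReal_ofReal hD, smul_eq_mul] at h2
  exact h1.trans h2

/-- ★ **`L²` mixing from a deterministic start at the spectral rate.**  For every torus size `L` and coupling `β'` there is
`c > 0` — an `L²(μ_{β'})` rate of the SZZ dynamics with constant one (first conjunct, `wilson_spectralGap`) — such that for every
start `z` and burn-in `t₁ > 0` there is `D ≥ 0` with: for EVERY strong solution `U` from `z` on ANY probability space, every
continuous `F` and every lattice time `t`,
`(∫ F(U_{t₁+t}) dP − ∫ F dμ_{β'})² ≤ D · e^{-2ct} · ∫ (F − ∫F dμ_{β'})² dμ_{β'}`.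
[cite: RobertsRosenthal1997, Theorem 2.1] [cite: ShenZhuZhu2022, §3 Lemma 3.3 (p. 13)] -/
theorem coldStart_sq_sub_le_exp (L : ℕ) [NeZero L] (β' : ℝ) :
    ∃ c : ℝ, 0 < c ∧
      (∀ (κ : ℝ≥0 → Kernel (GaugeConfig 3 L (Matrix.specialUnitaryGroup (Fin 2) ℂ))
          (GaugeConfig 3 L (Matrix.specialUnitaryGroup (Fin 2) ℂ))) [∀ t, IsMarkovKernel (κ t)],
        (∀ (t : ℝ≥0) (x : GaugeConfig 3 L (Matrix.specialUnitaryGroup (Fin 2) ℂ))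
          (Ω : Type) [MeasurableSpace Ω] (P : Measure Ω) [IsProbabilityMeasure P]
          (W : ℝ≥0 → Ω → (Edge 3 L × NoiseIdx 2 → ℝ)) (hW : IsFlatBrownian W P)
          (U : ℝ≥0 → Ω → GaugeConfig 3 L (Matrix.specialUnitaryGroup (Fin 2) ℂ)),
          (∀ ω, U 0 ω = x) →
          (latticeLangevinDynamics (fundamentalLatticeRep 2) β').IsSolution (fundamentalRep (Fin 2))
            hW.natFiltration P W U →
          κ t x = P.map (U t)) →
        ∀ (F : GaugeConfig 3 L (Matrix.specialUnitaryGroup (Fin 2) ℂ) → ℝ), Continuous F →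
          ∫ x, F x ∂(wilsonMeasure (d := 3) (L := L) (fundamentalRep (Fin 2)) β') = 0 → ∀ t : ℝ≥0,
            ∫ x, F x * (∫ y, F y ∂(κ t x)) ∂(wilsonMeasure (d := 3) (L := L) (fundamentalRep (Fin 2)) β') ≤
              Real.exp (-c * t) * ∫ x, F x * F x ∂(wilsonMeasure (d := 3) (L := L) (fundamentalRep (Fin 2)) β')) ∧
      ∀ (z : GaugeConfig 3 L (Matrix.specialUnitaryGroup (Fin 2) ℂ)) (t₁ : ℝ≥0), 0 < (t₁ : ℝ) →
        ∃ D : ℝ, 0 ≤ D ∧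
          ∀ (Ω : Type) [MeasurableSpace Ω] (P : Measure Ω) [IsProbabilityMeasure P]
            (W : ℝ≥0 → Ω → (Edge 3 L × NoiseIdx 2 → ℝ)) (hW : IsFlatBrownian W P)
            (U : ℝ≥0 → Ω → GaugeConfig 3 L (Matrix.specialUnitaryGroup (Fin 2) ℂ)),
            (∀ ω, U 0 ω = z) →
            (latticeLangevinDynamics (fundamentalLatticeRep 2) β').IsSolution (fundamentalRep (Fin 2))
              hW.natFiltration P W U →
            ∀ (F : GaugeConfig 3 L (Matrix.specialUnitaryGroup (Fin 2) ℂ) → ℝ), Continuous F → ∀ t : ℝ≥0,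
              ((∫ ω, F (U (t₁ + t) ω) ∂P) - ∫ x, F x ∂(wilsonMeasure (d := 3) (L := L) (fundamentalRep (Fin 2)) β')) ^ 2 ≤
                D * Real.exp (-2 * c * t) *
                  ∫ x, (F x - ∫ z, F z ∂(wilsonMeasure (d := 3) (L := L) (fundamentalRep (Fin 2)) β')) ^ 2
                    ∂(wilsonMeasure (d := 3) (L := L) (fundamentalRep (Fin 2)) β') := by
  classical
  haveI := secondCountableTopology_su2
  haveI := borelSpace_config L
  haveI : IsProbabilityMeasure (wilsonMeasure (d := 3) (L := L) (fundamentalRep (Fin 2)) β') :=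
    isProbabilityMeasure_wilsonMeasure (d := 3) (L := L) (fundamentalRep (Fin 2)) (continuous_fundamentalRep (Fin 2)) β'
  obtain ⟨c, hc, hgap⟩ := wilson_spectralGap L β'
  refine ⟨c, hc, fun κ _ hreal F hF hF0 t => (hgap κ hreal F hF t).1 hF0, fun z t₁ ht₁ => ?_⟩
  set μ : Measure (GaugeConfig 3 L (Matrix.specialUnitaryGroup (Fin 2) ℂ)) :=
    wilsonMeasure (d := 3) (L := L) (fundamentalRep (Fin 2)) β' with hμ
  -- THE kernels and the density bound at time `t₁`
  obtain ⟨κ, hκ, -, hreal⟩ := exists_transitionKernel L β'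
  haveI := hκ
  obtain ⟨a, ha, -, hπle⟩ := wilsonMeasure_le_smul_pi_haar_and (L := L) β'
  haveI := isProbabilityMeasure_piWiener (Edge 3 L × NoiseIdx 2)
  have hWc := isFlatBrownian_piWiener 3 L (NoiseIdx 2)
  obtain ⟨Uc, hUc0, hUc⟩ := solution_from_start hWc β' z
  obtain ⟨C₁, hC₁, hle₁⟩ := map_le_smul_haar (L := L) β' ht₁ z hWc hUc0 hUc
  have hκle : κ t₁ z ≤ (ENNReal.ofReal (C₁ * a)) • μ := by
    rw [hreal t₁ z _ _ _ hWc Uc hUc0 hUc, ENNReal.ofReal_mul hC₁, Measure.le_iff]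
    intro A hA
    have e1 := Measure.le_iff.1 hle₁ A hA
    have e2 := Measure.le_iff.1 hπle A hA
    simp only [Measure.smul_apply, smul_eq_mul] at e1 e2 ⊢
    calc (Measure.map (Uc t₁) (Measure.pi fun _ : Edge 3 L × NoiseIdx 2 => preWienerMeasure)) A
        ≤ ENNReal.ofReal C₁ * (Measure.pi fun _ : Edge 3 L => haarProbability (Matrix.specialUnitaryGroup (Fin 2) ℂ)) A := e1
      _ ≤ ENNReal.ofReal C₁ * (ENNReal.ofReal a * μ A) := mul_le_mul' le_rfl e2
      _ = ENNReal.ofReal C₁ * ENNReal.ofReal a * μ A := (mul_assoc _ _ _).symm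
  refine ⟨C₁ * a, by positivity, fun Ω _ P _ W hW U hU0 hU F hF t => ?_⟩
  -- `E F(U_{t₁+t}) = ∫ (κ_t F) d(κ_{t₁} z)`
  have hFi : ∀ (ν : Measure (GaugeConfig 3 L (Matrix.specialUnitaryGroup (Fin 2) ℂ))) [IsProbabilityMeasure ν],
      Integrable F ν := fun ν _ => integrable_of_continuous_of_compactSpace hF ν
  have hmU : Measurable (U (t₁ + t)) := (hU.adapted (t₁ + t)).mono (hW.natFiltration.le (t₁ + t)) le_rfl
  have hE : ∫ ω, F (U (t₁ + t) ω) ∂P = ∫ y, (∫ y', F y' ∂(κ t y)) ∂(κ t₁ z) := by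
    rw [← integral_map hmU.aemeasurable hF.aestronglyMeasurable, ← hreal (t₁ + t) z Ω P W hW U hU0 hU,
      chapmanKolmogorov_szz β' κ hreal t₁ t]
    haveI : IsProbabilityMeasure ((κ t ∘ₖ κ t₁) z) := by
      rw [← chapmanKolmogorov_szz β' κ hreal t₁ t]; infer_instance
    exact Kernel.integral_comp (hFi _)
  -- centre and apply Jensen + domination + variance decay
  set m : ℝ := ∫ x, F x ∂μ with hm
  have hGc : Continuous fun y => (∫ y', F y' ∂(κ t y)) - m :=
    (continuous_integral_transitionKernel L β' κ hreal t hF).sub continuous_const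
  have hcent : (∫ ω, F (U (t₁ + t) ω) ∂P) - m = ∫ y, ((∫ y', F y' ∂(κ t y)) - m) ∂(κ t₁ z) := by
    rw [hE, integral_sub (integrable_of_continuous_of_compactSpace
      (continuous_integral_transitionKernel L β' κ hreal t hF) _) (integrable_const m)]
    simp
  rw [hcent]
  have hJ := sq_integral_le_mul_integral_sq (L := L) (by positivity : (0 : ℝ) ≤ C₁ * a) hκle hGc
  have hvar := (hgap κ hreal F hF t).2.2
  calc (∫ y, ((∫ y', F y' ∂(κ t y)) - m) ∂(κ t₁ z)) ^ 2
      ≤ (C₁ * a) * ∫ y, ((∫ y', F y' ∂(κ t y)) - m) ^ 2 ∂μ := hJ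
    _ ≤ (C₁ * a) * (Real.exp (-2 * c * t) * ∫ x, (F x - m) ^ 2 ∂μ) :=
        mul_le_mul_of_nonneg_left hvar (by positivity)
    _ = C₁ * a * Real.exp (-2 * c * t) * ∫ x, (F x - m) ^ 2 ∂μ := by ring

end Summit.QuantumFields.YangMills.Theorems.ColdStartUniversality

end
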